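import Summits.CriticalPhenomena.Ising3DConformalLimit.Theorems.MonotoneBlockingMonotoneBlockingTwoKarlinDefs
import HarnessLib

/-!
# The infrared envelope of a scale-totally-positive kernel (line `Sketch`, crux `MonotoneBlockingTwo`, stmt-CriticalPhenomena-17054)

Route `MonotoneBlocking`, sub-problem `CriticalPhenomena/Ising3DConformalLimit`. This file records, kernel-checked, the analytic
core of the obstruction that kills the TRANSFER stub `CriticalKarlinRepresentable` of line `Sketch` (idea `karlin-scale-tp2`;
`Cruxes/MonotoneBlockingTwo/Lines/Sketch.dead.md`): a kernel of the class `KarlinClass` can only ENHANCE its infrared power law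
toward the ultraviolet, in every direction of the open orthant.

* `KarlinClass.dyadic_logConvex` — one instance of the class axiom `mtp2` (at `(2^{j+1}, y)` and `(2^j, 2y)`): along every ray
  the dyadic samples `j ↦ Γ(2ʲy)` are log-convex, `Γ(2^{j+1}y)² ≤ Γ(2ʲy)·Γ(2^{j+2}y)`.
* `le_of_logConvex_tendsto` — a log-convex sequence of non-negative reals converging to a positive limit dominates its limit.
* `KarlinClass.irEnvelope` (registered sub-goal `irEnvelope` of the crux item) — if `Γ(2ʲy)·(2ᵃ)ʲ → A > 0` (the kernel has
  the infrared power law `A|·|^{-a}` along the ray of `y`, normalised at `y`), then `A ≤ Γ(y)`: **`Γ(y) ≥ A_IR(ŷ)|y|^{-a}` pointwise.**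

Consequence used in the dead-line verdict (numbers there, not here): with the isotropic infrared amplitude `A = 0.3045(5)` and
`a = 2Δ = 1.036298` of the critical two-point function, every representable lattice kernel obeys `G(z) ≥ A·K_{2Δ}(z)` (`K` the
cell-smeared pure power law, exactly computable), while the measured `G(1,1,1) = 0.163–0.165` lies 4.6–5.6 % below
`A·K_{2Δ}(1,1,1) = 0.1731` — the nearest-neighbour model's ultraviolet deficit on the diagonals.
-/

noncomputable section

namespace Summit.CriticalPhenomena.Ising3DConformalLimit.Cruxes.MonotoneBlockingTwo.KarlinScaleTP2

open Filter Topology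

/-- **Dyadic log-convexity along rays** (one instance of `KarlinClass.mtp2`): for `y` in the open orthant and every `j`,
`Γ(2^{j+1} y)² ≤ Γ(2ʲ y) · Γ(2^{j+2} y)`. -/
theorem KarlinClass.dyadic_logConvex {Γ : ℝ → ℝ → ℝ → ℝ} (hK : KarlinClass Γ) {y₁ y₂ y₃ : ℝ} (h₁ : 0 < y₁) (h₂ : 0 < y₂)
    (h₃ : 0 < y₃) (j : ℕ) :
    Γ (2 ^ (j + 1) * y₁) (2 ^ (j + 1) * y₂) (2 ^ (j + 1) * y₃) * Γ (2 ^ (j + 1) * y₁) (2 ^ (j + 1) * y₂) (2 ^ (j + 1) * y₃) ≤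
      Γ (2 ^ j * y₁) (2 ^ j * y₂) (2 ^ j * y₃) * Γ (2 ^ (j + 2) * y₁) (2 ^ (j + 2) * y₂) (2 ^ (j + 2) * y₃) := by
  have hmt := hK.mtp2 (2 ^ (j + 1)) (2 ^ j) y₁ y₂ y₃ (2 * y₁) (2 * y₂) (2 * y₃) (by positivity) (by positivity) h₁ h₂ h₃
    (by positivity) (by positivity) (by positivity)
  have hpow : ((2:ℝ) ^ j) ≤ 2 ^ (j + 1) := pow_le_pow_right₀ one_le_two (Nat.le_succ j)
  have e1 : ∀ {y : ℝ}, 0 < y → max y (2 * y) = 2 * y := fun hy => max_eq_right (by linarith)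
  have e2 : ∀ {y : ℝ}, 0 < y → min y (2 * y) = y := fun hy => min_eq_left (by linarith)
  rw [max_eq_left hpow, min_eq_right hpow, e1 h₁, e1 h₂, e1 h₃, e2 h₁, e2 h₂, e2 h₃] at hmt
  have p1 : ∀ y : ℝ, (2:ℝ) ^ j * (2 * y) = 2 ^ (j + 1) * y := fun y => by ring
  have p2 : ∀ y : ℝ, (2:ℝ) ^ (j + 1) * (2 * y) = 2 ^ (j + 2) * y := fun y => by ring
  rw [p1, p1, p1, p2, p2, p2] at hmt
  calc Γ (2 ^ (j + 1) * y₁) (2 ^ (j + 1) * y₂) (2 ^ (j + 1) * y₃) * Γ (2 ^ (j + 1) * y₁) (2 ^ (j + 1) * y₂) (2 ^ (j + 1) * y₃)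
      ≤ Γ (2 ^ (j + 2) * y₁) (2 ^ (j + 2) * y₂) (2 ^ (j + 2) * y₃) * Γ (2 ^ j * y₁) (2 ^ j * y₂) (2 ^ j * y₃) := hmt
    _ = _ := mul_comm _ _

/-- If a sequence of non-negative reals is log-convex (`w(j+1)² ≤ w(j)·w(j+2)`) and converges to a positive limit `A`, then it
is positive, its ratios are non-decreasing and tend to `1`, so it is non-increasing and **dominates its limit**: `A ≤ w j`. -/
theorem le_of_logConvex_tendsto {w : ℕ → ℝ} {A : ℝ} (hA : 0 < A) (hw0 : ∀ j, 0 ≤ w j)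
    (hconv : ∀ j, w (j + 1) * w (j + 1) ≤ w j * w (j + 2)) (hlim : Tendsto w atTop (𝓝 A)) (j : ℕ) : A ≤ w j := by
  -- positivity of every term
  have hpos : ∀ j, 0 < w j := by
    by_contra h
    push Not at h
    obtain ⟨j₀, hj₀⟩ := h
    have hz0 : w j₀ = 0 := le_antisymm hj₀ (hw0 j₀)
    -- then every later term vanishes
    have hz : ∀ n, w (j₀ + n + 1) = 0 := by
      intro n
      induction n with
      | zero =>
        have h1 := hconv j₀
        rw [hz0, zero_mul] at h1
        have : w (j₀ + 1) * w (j₀ + 1) = 0 := le_antisymm h1 (mul_self_nonneg _)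
        simpa using this
      | succ n ih =>
        have h1 := hconv (j₀ + n + 1)
        rw [ih, zero_mul] at h1
        have : w (j₀ + n + 1 + 1) * w (j₀ + n + 1 + 1) = 0 := le_antisymm h1 (mul_self_nonneg _)
        have h2 : w (j₀ + n + 1 + 1) = 0 := by simpa using this
        rw [show j₀ + (n + 1) + 1 = j₀ + n + 1 + 1 by omega]
        exact h2
    have hev : ∀ᶠ n in atTop, w n = 0 := by
      refine eventually_atTop.2 ⟨j₀ + 1, fun n hn => ?_⟩
      obtain ⟨m, rfl⟩ := Nat.exists_eq_add_of_le hn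
      rw [show j₀ + 1 + m = j₀ + m + 1 by omega]
      exact hz m
    have hlim0 : Tendsto w atTop (𝓝 0) :=
      (tendsto_congr' (hev.mono fun n hn => hn)).mpr tendsto_const_nhds
    exact absurd (tendsto_nhds_unique hlim hlim0) hA.ne'
  -- ratios are monotone and tend to 1
  set q : ℕ → ℝ := fun j => w (j + 1) / w j with hq
  have hmono : Monotone q := by
    refine monotone_nat_of_le_succ fun j => ?_
    simp only [hq]
    rw [div_le_div_iff₀ (hpos j) (hpos (j + 1))]
    calc w (j + 1) * w (j + 1) ≤ w j * w (j + 2) := hconv j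
      _ = w (j + 1 + 1) * w j := by ring_nf
  have hq1 : Tendsto q atTop (𝓝 1) := by
    have h1 : Tendsto (fun j => w (j + 1)) atTop (𝓝 A) := hlim.comp (tendsto_add_atTop_nat 1)
    have := h1.div hlim hA.ne'
    rwa [div_self hA.ne'] at this
  have hqle : ∀ j, q j ≤ 1 := fun j => hmono.ge_of_tendsto hq1 j
  -- hence `w` is non-increasing and dominates its limit
  have hanti : Antitone w := by
    refine antitone_nat_of_succ_le fun j => ?_
    have := hqle j
    simp only [hq] at this
    rwa [div_le_one (hpos j)] at this
  exact hanti.le_of_tendsto hlim j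

/-- **The infrared envelope** (registered sub-goal `irEnvelope`): for `Γ ∈ 𝒦` and `y` in the open orthant, if the dyadic
samples have the infrared power law `Γ(2ʲ y)·(2ᵃ)ʲ → A > 0`, then `A ≤ Γ(y)` — i.e. `Γ(y) ≥ A_IR(ŷ)·|y|^{-a}` with `A_IR` the
amplitude of the ray (`(2ᵃ)ʲ = 2^{aj}`; normalisation at `y`). A class kernel only ENHANCES its infrared power law inward. -/
theorem KarlinClass.irEnvelope {Γ : ℝ → ℝ → ℝ → ℝ} (hK : KarlinClass Γ) {y₁ y₂ y₃ a A : ℝ} (h₁ : 0 < y₁) (h₂ : 0 < y₂)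
    (h₃ : 0 < y₃) (hA : 0 < A)
    (hlim : Tendsto (fun j : ℕ => Γ (2 ^ j * y₁) (2 ^ j * y₂) (2 ^ j * y₃) * ((2:ℝ) ^ a) ^ j) atTop (𝓝 A)) :
    A ≤ Γ y₁ y₂ y₃ := by
  have hc : 0 < (2:ℝ) ^ a := Real.rpow_pos_of_pos two_pos a
  set w : ℕ → ℝ := fun j => Γ (2 ^ j * y₁) (2 ^ j * y₂) (2 ^ j * y₃) * ((2:ℝ) ^ a) ^ j with hw
  have hw0 : ∀ j, 0 ≤ w j := fun j => mul_nonneg (hK.nonneg _ _ _) (pow_nonneg hc.le j)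
  have hconv : ∀ j, w (j + 1) * w (j + 1) ≤ w j * w (j + 2) := by
    intro j
    have hΓ := hK.dyadic_logConvex h₁ h₂ h₃ j
    have hcc : 0 ≤ ((2:ℝ) ^ a) ^ j * ((2:ℝ) ^ a) ^ (j + 2) := by positivity
    calc w (j + 1) * w (j + 1)
        = (Γ (2 ^ (j + 1) * y₁) (2 ^ (j + 1) * y₂) (2 ^ (j + 1) * y₃) *
            Γ (2 ^ (j + 1) * y₁) (2 ^ (j + 1) * y₂) (2 ^ (j + 1) * y₃)) * (((2:ℝ) ^ a) ^ j * ((2:ℝ) ^ a) ^ (j + 2)) := by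
          simp only [hw]; ring
      _ ≤ (Γ (2 ^ j * y₁) (2 ^ j * y₂) (2 ^ j * y₃) * Γ (2 ^ (j + 2) * y₁) (2 ^ (j + 2) * y₂) (2 ^ (j + 2) * y₃)) *
            (((2:ℝ) ^ a) ^ j * ((2:ℝ) ^ a) ^ (j + 2)) := mul_le_mul_of_nonneg_right hΓ hcc
      _ = w j * w (j + 2) := by simp only [hw]; ring
  have := le_of_logConvex_tendsto hA hw0 hconv hlim 0
  simpa [hw] using this

/-- **Registered sub-goal `irEnvelope`** (verbatim signature): the infrared envelope of a class kernel, see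
`KarlinClass.irEnvelope`. -/
theorem irEnvelope : ∀ {Γ : ℝ → ℝ → ℝ → ℝ}, KarlinClass Γ → ∀ {y₁ y₂ y₃ a A : ℝ}, 0 < y₁ → 0 < y₂ → 0 < y₃ → 0 < A →
    Filter.Tendsto (fun j : ℕ => Γ (2 ^ j * y₁) (2 ^ j * y₂) (2 ^ j * y₃) * ((2:ℝ) ^ a) ^ j) Filter.atTop (nhds A) →
      A ≤ Γ y₁ y₂ y₃ :=
  fun hK _ _ _ _ _ h₁ h₂ h₃ hA hlim => hK.irEnvelope h₁ h₂ h₃ hA hlim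

end Summit.CriticalPhenomena.Ising3DConformalLimit.Cruxes.MonotoneBlockingTwo.KarlinScaleTP2

end
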